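import Literature.NumberTheory.LFunctions.MontgomeryVaughanLogMeansWindow
import Literature.NumberTheory.LFunctions.MontgomeryVaughanLogMeans
import Mathlib.Analysis.Fourier.FourierTransformDeriv
import Mathlib.NumberTheory.Harmonic.Bounds
import HarnessLib

/-!
# Montgomery–Vaughan 2001, toward Theorem 3: the weighted mean square of `S₁`

Support file (everything PROVED, no definitions, no named facts) for the discharge of
`Literature.NumberTheory.LFunctions.MontgomeryVaughan2001_thm3` (H. L. Montgomery, R. C. Vaughan,
*Mean values of multiplicative functions*, Period. Math. Hungar. 43 (2001), Theorem 3).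

In the proof of Theorem 2 of the paper (Roy–Vatwani 2019, §6.1, (eq:T1step1general) and the two
displays following "followed by Plancherel's identity") the logarithmically weighted partial sums
`S₁(u) log u = Σ_{n ≤ u} f(n) log n/n + Σ_{n ≤ u} f(n) log(u/n)/n` are controlled in mean square
through the Plancherel identities with `F'(1+α+it)/(α+it)` and `F(1+α+it)/(α+it)²`.  Here both are
obtained at once, for `f : ℕ →*₀ ℂ` with `|f| ≤ 1`, `F(s) = Σ f(n)n^{-s}` and `α > 0`:

`∫_ℝ u² |S₁(e^u)|² e^{−2αu} du = (1/2π) ∫_ℝ |F'(1+α+iy)/(α+iy) − F(1+α+iy)/(α+iy)²|² dy`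
(`integral_sq_mul_norm_S₁_sq_eq`):

the tree's Mellin–Plancherel set-up (`MellinPlancherel.fourier_phi`: the Fourier transform of
`φ(u) = e^{−αu}S₁(e^u)` is `F(1+s)/s`, `s = α + 2πiξ`), Mathlib's derivative of the Fourier
transform (`Real.hasDerivAt_fourier`: `𝓕(u ↦ −2πiu φ(u)) = (𝓕φ)'`) and the quotient rule
`(F(1+s)/s)' = 2πi(F'(1+s)/s − F(1+s)/s²)`, followed by Plancherel for `L¹ ∩ L²`
(`Literature.Analysis.FunctionSpaces.integral_norm_sq_fourierIntegral_eq`).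

## References
- [MontgomeryVaughan2001] H. L. Montgomery, R. C. Vaughan, *Mean values of multiplicative functions*,
  Period. Math. Hungar. 43 (2001), §3, proof of Theorem 2 (not held; read through:)
- [RoyVatwani2019] A. Roy, A. Vatwani, *Zeros of partial sums of L-functions*, arXiv:1807.11093, §6.1,
  (eq:T1 step1)–(eq:intg2 bound) (arXiv p. 14).
- [MontgomeryVaughan2007] H. L. Montgomery, R. C. Vaughan, *Multiplicative Number Theory I*, §5.1
  (Plancherel for Dirichlet series).
-/

noncomputable section

open Complex Real MeasureTheory Set Filter Finset FourierTransform

namespace Literature.NumberTheory.LFunctions.MontgomeryVaughan2001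

open MellinPlancherel (psum phi)

/-! ### The coefficients `a(n) = f(n)/n` -/

/-- `Σ_{ν=1}^N 1/ν ≤ 1 + log N` (`N ≥ 1`; Mathlib's harmonic bound). [folklore] -/
theorem sum_Icc_one_div_le_one_add_log (N : ℕ) :
    ∑ ν ∈ Finset.Icc 1 N, (1 : ℝ) / ν ≤ 1 + Real.log N := by
  have h := harmonic_le_one_add_log N
  rw [harmonic_eq_sum_Icc] at h
  push_cast at h
  simpa only [one_div] using h

/-- `S₁ f = psum (f ·/·)` (definitional). [folklore] -/
theorem S₁_eq_psum (f : ℕ → ℂ) (y : ℝ) : S₁ f y = psum (fun n => f n / n) y := rfl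

/-- **Growth of `S₁`**: `|S₁(y)| ≤ 1 + log y ≤ (1 + 2/α) y^{α/2}` for `y ≥ 1`, `α > 0`. [folklore] -/
theorem norm_psum_div_le (f : ℕ →*₀ ℂ) (hf : ∀ n, ‖f n‖ ≤ 1) {α : ℝ} (hα : 0 < α)
    (y : ℝ) (hy : 1 ≤ y) :
    ‖psum (fun n => f n / n) y‖ ≤ (1 + 2 / α) * y ^ (α / 2) := by
  have hy0 : 0 < y := by linarith
  have h1 : ‖psum (fun n => f n / n) y‖ ≤ 1 + Real.log y := by
    rw [← S₁_eq_psum]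
    refine (norm_S₁_le f hf y).trans ?_
    have hN : 1 ≤ ⌊y⌋₊ := Nat.le_floor (by simpa using hy)
    refine (sum_Icc_one_div_le_one_add_log ⌊y⌋₊).trans ?_
    have : Real.log (⌊y⌋₊ : ℝ) ≤ Real.log y :=
      Real.log_le_log (by exact_mod_cast hN) (Nat.floor_le hy0.le)
    linarith
  have h2 : Real.log y ≤ y ^ (α / 2) / (α / 2) := Real.log_le_rpow_div hy0.le (by positivity)
  have h3 : (1 : ℝ) ≤ y ^ (α / 2) := Real.one_le_rpow hy (by positivity)
  calc ‖psum (fun n => f n / n) y‖ ≤ 1 + Real.log y := h1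
    _ ≤ y ^ (α / 2) + y ^ (α / 2) / (α / 2) := by linarith
    _ = (1 + 2 / α) * y ^ (α / 2) := by field_simp

/-- `Σ |f(n)/n| n^{-α} < ∞` for `α > 0`. [folklore] -/
theorem summable_norm_div_div_rpow (f : ℕ →*₀ ℂ) (hf : ∀ n, ‖f n‖ ≤ 1) {α : ℝ} (hα : 0 < α) :
    Summable fun n : ℕ => ‖f n / n‖ / (n : ℝ) ^ α := by
  have hs : Summable fun n : ℕ => ((n : ℝ) ^ (1 + α))⁻¹ :=
    Real.summable_nat_rpow_inv.2 (by linarith)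
  refine Summable.of_nonneg_of_le (fun n => by positivity) (fun n => ?_) hs
  rcases Nat.eq_zero_or_pos n with rfl | hn
  · simp only [Nat.cast_zero, map_zero, zero_div, norm_zero]
    positivity
  · have hn0 : (0 : ℝ) < n := by exact_mod_cast hn
    have h1 : ‖f n / n‖ ≤ 1 / n := by
      rw [norm_div, Complex.norm_natCast]
      exact div_le_div_of_nonneg_right (hf n) hn0.le
    calc ‖f n / n‖ / (n : ℝ) ^ α ≤ (1 / n) / (n : ℝ) ^ α := div_le_div_of_nonneg_right h1 (by positivity)
      _ = ((n : ℝ) ^ (1 + α))⁻¹ := by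
          rw [Real.rpow_add hn0, Real.rpow_one]; field_simp

/-- The shifted Dirichlet series: `Σ (f(n)/n) n^{-s} = F(s+1)` for all `s`. [folklore] -/
theorem LSeries_div_eq (f : ℕ → ℂ) (s : ℂ) :
    LSeries (fun n => f n / n) s = LSeries f (s + 1) := by
  rw [LSeries, LSeries]
  refine tsum_congr fun n => ?_
  rcases Nat.eq_zero_or_pos n with rfl | hn
  · simp
  · have hn0 : (n : ℂ) ≠ 0 := by exact_mod_cast hn.ne'
    rw [LSeries.term_of_ne_zero hn.ne', LSeries.term_of_ne_zero hn.ne', Complex.cpow_add _ _ hn0,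
      Complex.cpow_one]
    field_simp

/-- `Σ (f(n)/n) n^{-s} = F(s+1)` as functions. [folklore] -/
theorem LSeries_div_eq_comp (f : ℕ → ℂ) :
    LSeries (fun n => f n / n) = fun s => LSeries f (s + 1) :=
  funext (LSeries_div_eq f)

/-- The derivative of the shifted series is the shifted derivative. [folklore] -/
theorem deriv_LSeries_div_eq (f : ℕ → ℂ) (s : ℂ) :
    deriv (LSeries (fun n => f n / n)) s = deriv (LSeries f) (s + 1) := by
  rw [LSeries_div_eq_comp, deriv_comp_add_const]

/-- The abscissa of absolute convergence of `Σ (f(n)/n)n^{-s}` is `≤ 0` for `|f| ≤ 1`. [folklore] -/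
theorem abscissaOfAbsConv_div_le (f : ℕ →*₀ ℂ) (hf : ∀ n, ‖f n‖ ≤ 1) :
    LSeries.abscissaOfAbsConv (fun n => f n / n) ≤ 0 := by
  have h := LSeries.abscissaOfAbsConv_le_of_le_const_mul_rpow (f := fun n => f n / n) (x := -1)
    ⟨1, fun n hn => ?_⟩
  · have h0 : ((-1 : ℝ) : EReal) + 1 = 0 := by
      rw [← EReal.coe_one, ← EReal.coe_add]; norm_num
    rwa [h0] at h
  · have hn0 : (0 : ℝ) < n := by exact_mod_cast Nat.pos_of_ne_zero hn
    rw [norm_div, Complex.norm_natCast, Real.rpow_neg_one, one_mul, div_eq_mul_inv]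
    exact mul_le_of_le_one_left (inv_nonneg.2 hn0.le) (hf n)

/-! ### The Fourier side: `𝓕φ = F(1+s)/s` and its derivative -/

/-- The path `ξ ↦ α + 2πiξ` has derivative `2πi`. [folklore] -/
theorem hasDerivAt_linePath (α ξ : ℝ) :
    HasDerivAt (fun ξ : ℝ => (α : ℂ) + ((2 * π * ξ : ℝ) : ℂ) * I) (((2 * π : ℝ) : ℂ) * I) ξ := by
  have h1 : HasDerivAt (fun ξ : ℝ => 2 * π * ξ) (2 * π) ξ := by
    simpa using (hasDerivAt_id ξ).const_mul (2 * π)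
  have h2 := (h1.ofReal_comp).mul_const I
  exact h2.const_add _

/-- **The derivative of `ξ ↦ L(s)/s`, `s = α + 2πiξ`** (`α > 0` beyond the abscissa of absolute
convergence): `(L(s)/s)' = 2πi (L'(s)/s − L(s)/s²)`. [folklore] -/
theorem hasDerivAt_LSeries_div_linePath {a : ℕ → ℂ} {α : ℝ} (hα : 0 < α)
    (habs : LSeries.abscissaOfAbsConv a < α) (ξ : ℝ) :
    HasDerivAt (fun ξ : ℝ => LSeries a ((α : ℂ) + ((2 * π * ξ : ℝ) : ℂ) * I) /
        ((α : ℂ) + ((2 * π * ξ : ℝ) : ℂ) * I))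
      ((((2 * π : ℝ) : ℂ) * I) *
        (deriv (LSeries a) ((α : ℂ) + ((2 * π * ξ : ℝ) : ℂ) * I) / ((α : ℂ) + ((2 * π * ξ : ℝ) : ℂ) * I) -
          LSeries a ((α : ℂ) + ((2 * π * ξ : ℝ) : ℂ) * I) / ((α : ℂ) + ((2 * π * ξ : ℝ) : ℂ) * I) ^ 2)) ξ := by
  set s : ℂ := (α : ℂ) + ((2 * π * ξ : ℝ) : ℂ) * I with hs
  have hsre : s.re = α := by simp [hs]
  have hs0 : s ≠ 0 := by
    intro h; have := congrArg Complex.re h; rw [hsre] at this; simp at this; linarith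
  have hp := hasDerivAt_linePath α ξ
  have hL : HasDerivAt (LSeries a) (deriv (LSeries a) s) s :=
    (LSeries_hasDerivAt (by rw [hsre]; exact_mod_cast habs)).differentiableAt.hasDerivAt
  have hcomp : HasDerivAt (fun ξ : ℝ => LSeries a ((α : ℂ) + ((2 * π * ξ : ℝ) : ℂ) * I))
      (deriv (LSeries a) s * (((2 * π : ℝ) : ℂ) * I)) ξ := by
    have := HasDerivAt.comp ξ (h₂ := LSeries a) (by rw [← hs]; exact hL) hp
    simpa [Function.comp_def] using this
  have hdiv := hcomp.div hp (by rw [← hs]; exact hs0)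
  rw [← hs] at hdiv
  have hdiv' : HasDerivAt (fun ξ : ℝ => LSeries a ((α : ℂ) + ((2 * π * ξ : ℝ) : ℂ) * I) /
      ((α : ℂ) + ((2 * π * ξ : ℝ) : ℂ) * I))
      ((deriv (LSeries a) s * (((2 * π : ℝ) : ℂ) * I) * s - LSeries a s * (((2 * π : ℝ) : ℂ) * I)) / s ^ 2) ξ :=
    hdiv
  refine hdiv'.congr_deriv ?_
  field_simp

/-- **The Fourier transform of `u ↦ −2πiu φ(u)`** is the derivative of `𝓕φ = L(s)/s`:
`𝓕(u ↦ −2πiu φ(u))(ξ) = 2πi (L'(s)/s − L(s)/s²)`, `s = α + 2πiξ`, for `φ(u) = e^{-αu}A(e^u)` with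
`|A(y)| ≤ C y^θ`, `θ < α`, and `Σ|a_n|n^{-α} < ∞`, `abscissa < α`. [folklore] -/
theorem fourier_mul_phi {a : ℕ → ℂ} {α θ C : ℝ} (hα : 0 < α) (hθ : θ < α)
    (hsum : Summable fun n : ℕ => ‖a n‖ / (n : ℝ) ^ α)
    (hbd : ∀ y : ℝ, 1 ≤ y → ‖psum a y‖ ≤ C * y ^ θ)
    (habs : LSeries.abscissaOfAbsConv a < α)
    (hint : Integrable fun u : ℝ => (u : ℂ) • phi a α u) (ξ : ℝ) :
    𝓕 (fun u : ℝ => (-2 * π * I * u) • phi a α u) ξ =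
      (((2 * π : ℝ) : ℂ) * I) *
        (deriv (LSeries a) ((α : ℂ) + ((2 * π * ξ : ℝ) : ℂ) * I) / ((α : ℂ) + ((2 * π * ξ : ℝ) : ℂ) * I) -
          LSeries a ((α : ℂ) + ((2 * π * ξ : ℝ) : ℂ) * I) / ((α : ℂ) + ((2 * π * ξ : ℝ) : ℂ) * I) ^ 2) := by
  have hφint : Integrable (phi a α) := MellinPlancherel.integrable_phi hbd hθ
  have hint' : Integrable fun u : ℝ => u • phi a α u := by
    refine hint.congr (Filter.Eventually.of_forall fun u => ?_)
    simp only [Complex.real_smul, smul_eq_mul]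
  have h1 := Real.hasDerivAt_fourier hφint hint' ξ
  have hF : 𝓕 (phi a α) = fun ξ : ℝ => LSeries a ((α : ℂ) + ((2 * π * ξ : ℝ) : ℂ) * I) /
      ((α : ℂ) + ((2 * π * ξ : ℝ) : ℂ) * I) :=
    funext fun ξ => MellinPlancherel.fourier_phi hα hsum ξ
  rw [hF] at h1
  have h2 := hasDerivAt_LSeries_div_linePath hα habs ξ
  exact h1.unique h2

/-! ### The weighted `φ`: integrability and square-integrability -/

/-- `y ≤ e^{y−1}`, hence `u e^{−cu} ≤ (1/c) e^{−(c/2)u}·(2/e) ≤ (2/c) e^{−(c/2)u}` for `u ≥ 0`,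
`c > 0`. [folklore] -/
theorem mul_exp_neg_le {c : ℝ} (hc : 0 < c) (u : ℝ) :
    u * Real.exp (-(c * u)) ≤ 2 / c * Real.exp (-(c / 2 * u)) := by
  have h := Real.add_one_le_exp (c / 2 * u - 1)
  have h1 : c / 2 * u ≤ Real.exp (c / 2 * u - 1) := by linarith
  have h2 : Real.exp (c / 2 * u - 1) ≤ Real.exp (c / 2 * u) := Real.exp_le_exp.2 (by linarith)
  have h3 : u ≤ 2 / c * Real.exp (c / 2 * u) := by
    rw [div_mul_eq_mul_div, le_div_iff₀ hc]
    nlinarith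
  have hsplit : Real.exp (-(c * u)) = Real.exp (-(c / 2 * u)) * Real.exp (-(c / 2 * u)) := by
    rw [← Real.exp_add]; congr 1; ring
  have hinv : Real.exp (c / 2 * u) * Real.exp (-(c / 2 * u)) = 1 := by
    rw [← Real.exp_add]; simp
  calc u * Real.exp (-(c * u)) ≤ (2 / c * Real.exp (c / 2 * u)) * Real.exp (-(c * u)) :=
        mul_le_mul_of_nonneg_right h3 (Real.exp_pos _).le
    _ = 2 / c * Real.exp (-(c / 2 * u)) * (Real.exp (c / 2 * u) * Real.exp (-(c / 2 * u))) := by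
        rw [hsplit]; ring
    _ = 2 / c * Real.exp (-(c / 2 * u)) := by rw [hinv, mul_one]

/-- **Pointwise bound for `u φ(u)`**: `‖u φ(u)‖ ≤ (2C/(α−θ)) e^{−((α−θ)/2)u}` for `u ≥ 0` and
`= 0` for `u < 0`. [folklore] -/
theorem norm_mul_phi_le {a : ℕ → ℂ} {α θ C : ℝ} (hθ : θ < α)
    (hbd : ∀ y : ℝ, 1 ≤ y → ‖psum a y‖ ≤ C * y ^ θ) (u : ℝ) :
    ‖(u : ℂ) • phi a α u‖ ≤
      (Set.Ici (0 : ℝ)).indicator (fun u => 2 * C / (α - θ) * Real.exp (-((α - θ) / 2 * u))) u := by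
  have hC := MellinPlancherel.const_nonneg hbd
  have hc : 0 < α - θ := by linarith
  rcases lt_or_ge u 0 with hu | hu
  · rw [MellinPlancherel.phi_of_neg a α hu, smul_zero, norm_zero,
      Set.indicator_of_notMem (by simpa using hu)]
  · rw [Set.indicator_of_mem (by exact hu), norm_smul, Complex.norm_real, Real.norm_of_nonneg hu]
    have h1 := MellinPlancherel.norm_phi_le (σ := α) hbd u
    rw [Set.indicator_of_mem (by exact hu)] at h1
    have h2 := mul_exp_neg_le hc u
    calc u * ‖phi a α u‖ ≤ u * (C * Real.exp (-((α - θ) * u))) := mul_le_mul_of_nonneg_left h1 hu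
      _ = C * (u * Real.exp (-((α - θ) * u))) := by ring
      _ ≤ C * (2 / (α - θ) * Real.exp (-((α - θ) / 2 * u))) := mul_le_mul_of_nonneg_left h2 hC
      _ = 2 * C / (α - θ) * Real.exp (-((α - θ) / 2 * u)) := by ring

/-- `u φ(u)` is integrable. [folklore] -/
theorem integrable_mul_phi {a : ℕ → ℂ} {α θ C : ℝ} (hθ : θ < α)
    (hbd : ∀ y : ℝ, 1 ≤ y → ‖psum a y‖ ≤ C * y ^ θ) :
    Integrable fun u : ℝ => (u : ℂ) • phi a α u := by
  have hc : 0 < α - θ := by linarith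
  have hg : Integrable ((Set.Ici (0 : ℝ)).indicator
      (fun u => 2 * C / (α - θ) * Real.exp (-((α - θ) / 2 * u)))) := by
    rw [integrable_indicator_iff measurableSet_Ici, integrableOn_Ici_iff_integrableOn_Ioi]
    have h0 : IntegrableOn (fun u : ℝ => 2 * C / (α - θ) * Real.exp (-((α - θ) / 2) * u)) (Set.Ioi 0) :=
      (exp_neg_integrableOn_Ioi 0 (b := (α - θ) / 2) (by positivity)).const_mul _
    refine IntegrableOn.congr_fun h0 (fun u _ => ?_) measurableSet_Ioi
    show 2 * C / (α - θ) * Real.exp (-((α - θ) / 2) * u) = 2 * C / (α - θ) * Real.exp (-((α - θ) / 2 * u))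
    rw [neg_mul]
  refine hg.mono' ?_ (Filter.Eventually.of_forall (norm_mul_phi_le hθ hbd))
  exact (Complex.measurable_ofReal.smul (MellinPlancherel.measurable_phi a α)).aestronglyMeasurable

/-- `u φ(u)` is bounded: `‖u φ(u)‖ ≤ 2C/(α−θ)`. [folklore] -/
theorem norm_mul_phi_le_const {a : ℕ → ℂ} {α θ C : ℝ} (hθ : θ < α)
    (hbd : ∀ y : ℝ, 1 ≤ y → ‖psum a y‖ ≤ C * y ^ θ) (u : ℝ) :
    ‖(u : ℂ) • phi a α u‖ ≤ 2 * C / (α - θ) := by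
  have hC := MellinPlancherel.const_nonneg hbd
  have hc : 0 < α - θ := by linarith
  refine (norm_mul_phi_le hθ hbd u).trans ?_
  rcases lt_or_ge u 0 with hu | hu
  · rw [Set.indicator_of_notMem (by simpa using hu)]; positivity
  · rw [Set.indicator_of_mem (by exact hu)]
    have : Real.exp (-((α - θ) / 2 * u)) ≤ 1 := Real.exp_le_one_iff.2 (by nlinarith)
    calc 2 * C / (α - θ) * Real.exp (-((α - θ) / 2 * u)) ≤ 2 * C / (α - θ) * 1 :=
          mul_le_mul_of_nonneg_left this (by positivity)
      _ = 2 * C / (α - θ) := mul_one _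

/-! ### The identity -/

/-- **Plancherel for the logarithmically weighted partial sums** (general coefficients): for
`Σ|a_n|n^{-α} < ∞` (`α > 0`, abscissa of absolute convergence `< α`) and `|A(y)| ≤ C y^θ`, `θ < α`,
`∫_ℝ u² |A(e^u)|² e^{−2αu} du = (1/2π) ∫_ℝ |L'(α+iy)/(α+iy) − L(α+iy)/(α+iy)²|² dy`.
[cite: MontgomeryVaughan2007, §5.1 (Plancherel for Dirichlet series)] -/
theorem integral_sq_mul_norm_psum_sq_eq {a : ℕ → ℂ} {α θ C : ℝ} (hα : 0 < α) (hθ : θ < α)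
    (hsum : Summable fun n : ℕ => ‖a n‖ / (n : ℝ) ^ α)
    (hbd : ∀ y : ℝ, 1 ≤ y → ‖psum a y‖ ≤ C * y ^ θ)
    (habs : LSeries.abscissaOfAbsConv a < α) :
    ∫ u : ℝ, u ^ 2 * ‖psum a (Real.exp u)‖ ^ 2 * Real.exp (-(2 * α * u)) =
      (1 / (2 * π)) * ∫ y : ℝ, ‖deriv (LSeries a) (α + y * I) / (α + y * I) -
        LSeries a (α + y * I) / ((α : ℂ) + y * I) ^ 2‖ ^ 2 := by
  set ψ : ℝ → ℂ := fun u : ℝ => (-2 * π * I * u) • phi a α u with hψ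
  have hint := integrable_mul_phi hθ hbd (a := a) (α := α)
  -- `ψ = (-2πi) • (u φ)`
  have hψeq : ψ = fun u : ℝ => (-2 * π * I) • ((u : ℂ) • phi a α u) := by
    funext u; simp only [hψ, smul_smul]
  have hψint : Integrable ψ := by rw [hψeq]; exact hint.smul (-2 * π * I : ℂ)
  have hn2πI : ‖(-2 * π * I : ℂ)‖ = 2 * π := by
    rw [show (-2 * π * I : ℂ) = ((-(2 * π) : ℝ) : ℂ) * I by push_cast; ring, norm_mul, Complex.norm_I,
      mul_one, Complex.norm_real, Real.norm_eq_abs, abs_neg, abs_of_pos (by positivity)]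
  have hψbd : ∀ u, ‖ψ u‖ ≤ 2 * π * (2 * C / (α - θ)) := by
    intro u
    rw [hψeq]
    show ‖(-2 * π * I : ℂ) • ((u : ℂ) • phi a α u)‖ ≤ _
    rw [norm_smul, hn2πI]
    exact mul_le_mul_of_nonneg_left (norm_mul_phi_le_const hθ hbd u) (by positivity)
  have hψL2 : MemLp ψ 2 := WindowPlancherel.memLp_two_of_norm_le hψint hψbd
  -- Plancherel
  have hP := Literature.Analysis.FunctionSpaces.integral_norm_sq_fourierIntegral_eq hψint hψL2
  -- the left side
  have hL : ∫ u : ℝ, ‖ψ u‖ ^ 2 = (2 * π) ^ 2 * ∫ u : ℝ, u ^ 2 * ‖psum a (Real.exp u)‖ ^ 2 * Real.exp (-(2 * α * u)) := by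
    rw [← integral_const_mul]
    refine integral_congr_ae (Filter.Eventually.of_forall fun u => ?_)
    simp only [hψ, norm_smul, MellinPlancherel.norm_phi]
    have hn : ‖(-2 * π * I * u : ℂ)‖ = 2 * π * |u| := by
      rw [show (-2 * π * I * u : ℂ) = ((-(2 * π * u) : ℝ) : ℂ) * I by push_cast; ring, norm_mul,
        Complex.norm_I, mul_one, Complex.norm_real, Real.norm_eq_abs, abs_neg, abs_mul, abs_mul, abs_two,
        abs_of_pos Real.pi_pos]
    have hexp2 : Real.exp (-(α * u)) ^ 2 = Real.exp (-(2 * α * u)) := by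
      rw [← Real.exp_nat_mul]; congr 1; push_cast; ring
    rw [hn, show (2 * π * |u| * (Real.exp (-(α * u)) * ‖psum a (Real.exp u)‖)) ^ 2 =
      (2 * π) ^ 2 * (|u| ^ 2 * ‖psum a (Real.exp u)‖ ^ 2 * Real.exp (-(α * u)) ^ 2) by ring, sq_abs, hexp2]
  -- the right side
  have hR : ∫ ξ : ℝ, ‖𝓕 ψ ξ‖ ^ 2 = (2 * π) ^ 2 * ((1 / (2 * π)) * ∫ y : ℝ, ‖deriv (LSeries a) (α + y * I) / (α + y * I) -
        LSeries a (α + y * I) / ((α : ℂ) + y * I) ^ 2‖ ^ 2) := by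
    set G : ℝ → ℝ := fun y => ‖deriv (LSeries a) (α + y * I) / (α + y * I) -
        LSeries a (α + y * I) / ((α : ℂ) + y * I) ^ 2‖ ^ 2 with hG
    have h1 : ∫ ξ : ℝ, ‖𝓕 ψ ξ‖ ^ 2 = ∫ ξ : ℝ, (2 * π) ^ 2 * G ((2 * π) * ξ) := by
      refine integral_congr_ae (Filter.Eventually.of_forall fun ξ => ?_)
      simp only [hG, hψ]
      rw [fourier_mul_phi hα hθ hsum hbd habs hint ξ, norm_mul]
      have hn : ‖(((2 * π : ℝ) : ℂ) * I : ℂ)‖ = 2 * π := by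
        rw [norm_mul, Complex.norm_I, mul_one, Complex.norm_real, Real.norm_of_nonneg (by positivity)]
      rw [hn, mul_pow]
    rw [h1, integral_const_mul, Measure.integral_comp_mul_left G]
    have h2π : |(2 * π)⁻¹| = 1 / (2 * π) := by rw [abs_of_pos (by positivity), one_div]
    rw [h2π, smul_eq_mul]
  rw [hL, hR] at hP
  have h4 : (0 : ℝ) < (2 * π) ^ 2 := by positivity
  exact (mul_right_inj' h4.ne').1 hP.symm

/-- **The weighted mean square of `S₁`** (the Plancherel step of the proof of MV Theorem 2, both
identities at once): for `f` totally multiplicative with `|f| ≤ 1`, `F(s) = Σ f(n)n^{-s}`, `α > 0`,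
`∫_ℝ u² |S₁(e^u)|² e^{−2αu} du = (1/2π) ∫_ℝ |F'(1+α+iy)/(α+iy) − F(1+α+iy)/(α+iy)²|² dy`.
[cite: RoyVatwani2019, §6.1 (eq:T1step1general) and the two Plancherel displays] -/
theorem integral_sq_mul_norm_S₁_sq_eq (f : ℕ →*₀ ℂ) (hf : ∀ n, ‖f n‖ ≤ 1) {α : ℝ} (hα : 0 < α) :
    ∫ u : ℝ, u ^ 2 * ‖S₁ f (Real.exp u)‖ ^ 2 * Real.exp (-(2 * α * u)) =
      (1 / (2 * π)) * ∫ y : ℝ, ‖deriv (LSeries (f ·)) (1 + α + y * I) / (α + y * I) -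
        LSeries (f ·) (1 + α + y * I) / ((α : ℂ) + y * I) ^ 2‖ ^ 2 := by
  have h := integral_sq_mul_norm_psum_sq_eq (a := fun n => f n / n) (α := α) (θ := α / 2)
    (C := 1 + 2 / α) hα (by linarith) (summable_norm_div_div_rpow f hf hα)
    (fun y hy => norm_psum_div_le f hf hα y hy)
    ((abscissaOfAbsConv_div_le f hf).trans_lt (by exact_mod_cast hα))
  simp only [← S₁_eq_psum] at h
  rw [h]
  congr 1
  refine integral_congr_ae (Filter.Eventually.of_forall fun y => ?_)
  simp only
  rw [deriv_LSeries_div_eq, LSeries_div_eq]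
  congr 4 <;> ring

end Literature.NumberTheory.LFunctions.MontgomeryVaughan2001
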